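import Summits.NavierStokesRegularity.NavierStokesRegularity.Theses.LevelSetModeration
import HarnessLib

/-!
# Line `linear_closure` — skeleton of the crux `HighSpeedPressureWork`
# (route LevelSetModeration, item stmt-NavierStokesRegularity-18149; strategist gen 1, after line `Sketch` died)

The crux: for every `ν, T > 0` there are `m < 10/3` and a modulus `F` such that every classical
Leray–Hopf solution on `ℝ³ × [0,T)` from a rapidly decaying datum with `∫|u₀|² ≤ E₀`, `|u₀| ≤ B₀`
satisfies, for `M ≥ 2B₀`, `c ∈ [M/2, M]`, `t < T`,
`PW_c(t) := −∫₀ᵗ∫ (1−c/|u|)₊ ∇p̃·u ≤ √(F(E₀,B₀) M^m V_c(T)) · √(D_c(T))`,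
`V_c(T) = ∫₀ᵀ |{|u|>c}|`, `D_c(T) = ∫₀ᵀ∫ 1_{|u|>c} |∇|u||²`.

LINE (lens: strengthen-to-close / decomposition by strength). Two facts in the tree drive it.
(L) The landed De Giorgi closure `levelSetClosure_proof` (crux 3) consumes the crux ONLY through
    the LINEAR level-set law `ν² D_c(T) ≤ Λ M^m V_c(T)` and `∫(|u(t)|−c)₊² ≤ 4 Λ M^m V_c(T)/ν`
    (`levelSetEnergy_le_of_pairingBound`), and its closing threshold depends only on
    `(Λ, m, ν, Sobolev constant, ∫|u₀|², M₀)` — so the closure is CLASS-UNIFORM after a refactor.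
(E) Under a class-uniform a priori speed bound `‖u‖ ≤ G(E₀,B₀)` the crux holds with exponent `0`
    (levels above `2G+1` are empty — landed `Negative/ExponentCollapse` —; below, the ratio
    `PW²/(V D)` is class-bounded: the "bookkeeping", true on paper, early-window analysis included).
So the crux follows from three stubs:

* `stub_linearLevelSetLaw` (L1, OPEN — the load): the linear law above with some `m < 10/3` and a
  data modulus `Λ(E₀,B₀)`, for all `M ≥ 2B₀`, `c ∈ [M/2,M]`. It is a CONSEQUENCE of the crux
  (landed `levelSetEnergy_le_of_pairingBound` + proved `LevelSetEnergyInequality`), strictly weaker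
  in form (linear, pressure-free, no product, no persistence), and it is exactly what De Giorgi eats.
* `stub_uniformLevelSetClosure` (L2, PROVABLE NOW, M–L): the linear law on windows `M ≥ M₀` for one
  solution with `∫|u₀|² ≤ E₀`, `|u₀| ≤ M₀/2` bounds the speed by a constant `G` depending only on
  `(ν, T, m, Λ, E₀, M₀)` — refactor of `LevelSetModerationLevelSetClosure.lean` (replace `E2, KE` by
  their bounds `E₀, E₀/2` in `hbase`/`exists_window_threshold`; `hgain` verbatim).
* `stub_boundedPairingBookkeeping` (L3, TRUE on paper, L–XL): on a fibre with a class-uniform speed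
  bound `G(E₀,B₀)`, the pairing obeys the crux's product bound with NO `M`-factor and some modulus
  `F(E₀,B₀)`: above `2G+1` both sides vanish (`pressureWork_eq_zero_of_speed_lt`, landed); below,
  `PW = ½∫(|u|−c)₊² + νD̃` (exact balance; S0 of line `pressure_free_split`) and the ratio
  `PW²/(V_c D_c)` is bounded near (possibly flat) speed maxima, on plateaux (excluded dynamically by
  the moderated Cauchy–Schwarz `PW ≤ sup|p̃−Φ|√(V D)` per component) and in the early window
  `t ≲ ν/B₀²` (flat cores: `D/V ≈ (B₀⁴/ν²)Re_ℓ`, quadratic maxima need `Re_ℓ ≳ 1`; STRATEGY-CENSUS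
  §Decomposition D2). This is the bounded-amplification content EVERY line must prove; here it is
  isolated from the open law instead of being merged into it.
* `HighSpeedPressureWork_of`: the crux BY NAME (real proof): `(m, Λ)` from L1; `G(E₀,B₀)` from L2
  with `M₀ := 2·max(B₀,0)+2`; `F` from L3; exponent `0 < 10/3`, `M^0 = 1`.
-/

set_option linter.dupNamespace false

noncomputable section

open MeasureTheory Set Filter Topology
open scoped ENNReal

namespace Summit.NavierStokesRegularity.NavierStokesRegularity.Cruxes.HighSpeedPressureWork.LinearClosure

open Literature.Analysis.FluidPDE
open Summit.NavierStokesRegularity.NavierStokesRegularity.Theses.LevelSetModeration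

/-- **STUB L1 (OPEN — the load; linear level-set law = De Giorgi's exact input).** For every
`ν, T > 0` there are `m < 10/3` and a modulus `Λ` such that every classical Leray–Hopf solution from a
rapidly decaying datum with `∫|u₀|² ≤ E₀`, `|u₀| ≤ B₀` satisfies, for all `M ≥ 2B₀`, `c ∈ [M/2,M]`,
`c > 0`: `ν² D_c(T) ≤ Λ(E₀,B₀) M^m V_c(T)` and, for every `t < T`,
`∫(|u(t)|−c)₊² ≤ 4 Λ(E₀,B₀) M^m V_c(T)/ν` — the level-set dissipation and the excess speed energy above
an admissible level are controlled LINEARLY by `M^m ×` the space–time occupation of the level set.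
A consequence of the crux (`levelSetEnergy_le_of_pairingBound` with the proved
`LevelSetEnergyInequality`), with the same exponent and `Λ = F`. Why it might fail: only along a
family with unbounded amplification `M/B₀` at fixed `(E₀,B₀,ν,T)` (thin fast sheets at the viscous
scale `ν/M`, or fat brief flashes) — the blow-up regime; regularity-strength (Disproof §§1–3 apply
verbatim: exponent decorative modulo `APrioriSpeedBound`, `Λ ≳ B₀^{4−m}` along scaling orbits). -/
theorem stub_linearLevelSetLaw :
    ∀ (ν T : ℝ), 0 < ν → 0 < T → ∃ m : ℝ, m < 10 / 3 ∧ ∃ Λ : ℝ → ℝ → ℝ,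
      ∀ (u : ℝ → EuclideanSpace ℝ (Fin 3) → EuclideanSpace ℝ (Fin 3))
        (p : ℝ → EuclideanSpace ℝ (Fin 3) → ℝ),
        Literature.Analysis.FluidPDE.IsClassicalNSSolutionOn (Set.Ico 0 T) ν 0 u p →
        Literature.Analysis.FluidPDE.IsLerayHopfOn T ν 0 (u 0) u →
        Literature.Analysis.FluidPDE.HasRapidSpatialDecay (u 0) →
        ∀ (E₀ B₀ : ℝ), (∫ x, ‖u 0 x‖ ^ 2) ≤ E₀ → (∀ x, ‖u 0 x‖ ≤ B₀) →
        ∀ (M c : ℝ), 2 * B₀ ≤ M → M / 2 ≤ c → c ≤ M → 0 < c →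
        ν ^ 2 * (∫⁻ τ in Set.Ioo 0 T, ∫⁻ x, Set.indicator {x | c < ‖u τ x‖}
              (fun x => ENNReal.ofReal (‖fderiv ℝ (fun y => ‖u τ y‖) x‖ ^ 2)) x).toReal ≤
            Λ E₀ B₀ * M ^ m * (∫⁻ τ in Set.Ioo 0 T, volume {x | c < ‖u τ x‖}).toReal ∧
        ∀ t ∈ Set.Ico 0 T, (∫ x, (max (‖u t x‖ - c) 0) ^ 2) ≤
            4 * (Λ E₀ B₀ * M ^ m * (∫⁻ τ in Set.Ioo 0 T, volume {x | c < ‖u τ x‖}).toReal) / ν := by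
  sorry

/-- **STUB L2 (PROVABLE NOW, M–L — class-uniform De Giorgi closure).** For `ν, T > 0`, `m < 10/3`,
`M₀ > 0`, a real `Λ` and an energy bound `E₀` there is a constant `G` such that EVERY classical
Leray–Hopf solution from a rapidly decaying datum with `∫|u₀|² ≤ E₀`, `|u₀| ≤ M₀/2` obeying the linear
level-set law with `(Λ, m)` on all windows `M ≥ M₀`, `c ∈ [M/2, M]`, is bounded by `G` on `[0,T)`.
Proof = `levelSetClosure_proof` (Theorems/LevelSetModerationLevelSetClosure.lean) with the
solution-dependent quantities `E2 = ∫|u₀|²`, `KE = ½∫|u₀|²` replaced by `E₀`, `E₀/2` in the base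
step `hbase` and in the threshold `exists_window_threshold` (monotone in them); `hgain` (the
autonomous two-level gain `V(h) ≤ (c₀ M^{5m/3}+1)(h−k)^{-10/3} V(k)^{5/3}`), Stampacchia
(`LevelSetClosure.stub_stampacchia`) and the open-null-empty endgame are verbatim; `Λ` enters through
`max Λ 0`. -/
theorem stub_uniformLevelSetClosure :
    ∀ (ν T m Λ E₀ M₀ : ℝ), 0 < ν → 0 < T → m < 10 / 3 → 0 < M₀ → ∃ G : ℝ,
      ∀ (u : ℝ → EuclideanSpace ℝ (Fin 3) → EuclideanSpace ℝ (Fin 3))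
        (p : ℝ → EuclideanSpace ℝ (Fin 3) → ℝ),
        Literature.Analysis.FluidPDE.IsClassicalNSSolutionOn (Set.Ico 0 T) ν 0 u p →
        Literature.Analysis.FluidPDE.IsLerayHopfOn T ν 0 (u 0) u →
        Literature.Analysis.FluidPDE.HasRapidSpatialDecay (u 0) →
        (∫ x, ‖u 0 x‖ ^ 2) ≤ E₀ → (∀ x, ‖u 0 x‖ ≤ M₀ / 2) →
        (∀ (M c : ℝ), M₀ ≤ M → M / 2 ≤ c → c ≤ M → 0 < c →
          ν ^ 2 * (∫⁻ τ in Set.Ioo 0 T, ∫⁻ x, Set.indicator {x | c < ‖u τ x‖}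
                (fun x => ENNReal.ofReal (‖fderiv ℝ (fun y => ‖u τ y‖) x‖ ^ 2)) x).toReal ≤
              Λ * M ^ m * (∫⁻ τ in Set.Ioo 0 T, volume {x | c < ‖u τ x‖}).toReal ∧
          ∀ t ∈ Set.Ico 0 T, (∫ x, (max (‖u t x‖ - c) 0) ^ 2) ≤
              4 * (Λ * M ^ m * (∫⁻ τ in Set.Ioo 0 T, volume {x | c < ‖u τ x‖}).toReal) / ν) →
        ∀ t ∈ Set.Ico 0 T, ∀ x, ‖u t x‖ ≤ G := by
  sorry

/-- **STUB L3 (TRUE on paper, L–XL — bounded pairing bookkeeping).** On a fibre `(ν, T)` carrying a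
class-uniform a priori speed bound `‖u‖ ≤ G(E₀,B₀)` on `[0,T) × ℝ³`, there is a modulus `F` such that
every classical Leray–Hopf solution from a rapidly decaying datum with `∫|u₀|² ≤ E₀`, `|u₀| ≤ B₀`
satisfies the crux's pairing bound WITHOUT the `M`-factor:
`PW_c(t) ≤ √(F(E₀,B₀) V_c(T)) √(D_c(T))` for `M ≥ 2B₀`, `c ∈ [M/2,M]`, `t < T`.
Above `M* = 2G+1` the level sets are empty and both sides vanish (landed
`Negative.ExponentCollapse.pressureWork_eq_zero_of_speed_lt`); below, `PW = ½∫(|u(t)|−c)₊² + νD̃_c(t)`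
(exact balance) and the ratio `PW²/(V_c D_c)` is bounded class-uniformly: near (flat) speed maxima
(`ε⁶` vs `ε⁵`), on plateaux (excluded: `PW ≤ osc_component(p̃ | |u|) √(V D)`), in the early window
`t ≲ ν/B₀²` (`L^∞` mild theory, Giga–Inui–Matsui; flat cores `D/V ≈ (B₀⁴/ν²)Re_ℓ`). This is the
bounded-amplification content of the crux, separated from the open law. Why it is not routine: the
early window and the in-component oscillation bound of `p̃` under a speed bound are real lemmas
(STRATEGY-CENSUS §Decomposition D2/D5). -/
theorem stub_boundedPairingBookkeeping :
    ∀ (ν T : ℝ), 0 < ν → 0 < T → ∀ G : ℝ → ℝ → ℝ,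
      (∀ (u : ℝ → EuclideanSpace ℝ (Fin 3) → EuclideanSpace ℝ (Fin 3))
          (p : ℝ → EuclideanSpace ℝ (Fin 3) → ℝ),
          Literature.Analysis.FluidPDE.IsClassicalNSSolutionOn (Set.Ico 0 T) ν 0 u p →
          Literature.Analysis.FluidPDE.IsLerayHopfOn T ν 0 (u 0) u →
          Literature.Analysis.FluidPDE.HasRapidSpatialDecay (u 0) →
          ∀ (E₀ B₀ : ℝ), (∫ x, ‖u 0 x‖ ^ 2) ≤ E₀ → (∀ x, ‖u 0 x‖ ≤ B₀) →
          ∀ t ∈ Set.Ico 0 T, ∀ x, ‖u t x‖ ≤ G E₀ B₀) →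
      ∃ F : ℝ → ℝ → ℝ,
      ∀ (u : ℝ → EuclideanSpace ℝ (Fin 3) → EuclideanSpace ℝ (Fin 3))
        (p : ℝ → EuclideanSpace ℝ (Fin 3) → ℝ),
        Literature.Analysis.FluidPDE.IsClassicalNSSolutionOn (Set.Ico 0 T) ν 0 u p →
        Literature.Analysis.FluidPDE.IsLerayHopfOn T ν 0 (u 0) u →
        Literature.Analysis.FluidPDE.HasRapidSpatialDecay (u 0) →
        ∀ (E₀ B₀ : ℝ), (∫ x, ‖u 0 x‖ ^ 2) ≤ E₀ → (∀ x, ‖u 0 x‖ ≤ B₀) →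
        ∀ (M c t : ℝ), 2 * B₀ ≤ M → M / 2 ≤ c → c ≤ M → 0 < c → t ∈ Set.Ico 0 T →
        -(∫ τ in Set.Ioo 0 t, ∫ x, max (1 - c / ‖u τ x‖) 0 *
            (fderiv ℝ (Literature.Analysis.FluidPDE.normalisedPressure (u τ)) x (u τ x))) ≤
          Real.sqrt (F E₀ B₀ * (∫⁻ τ in Set.Ioo 0 T, volume {x | c < ‖u τ x‖}).toReal) *
            Real.sqrt ((∫⁻ τ in Set.Ioo 0 T, ∫⁻ x, Set.indicator {x | c < ‖u τ x‖}
              (fun x => ENNReal.ofReal (‖fderiv ℝ (fun y => ‖u τ y‖) x‖ ^ 2)) x).toReal) := by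
  sorry

/-- **The crux BY NAME from the three stubs** (sorries live only in `stub_*`): `(m, Λ)` from the
linear law; a class-uniform bound `G(E₀,B₀)` from the uniform closure with `M₀ := 2·max(B₀,0)+2`;
the modulus `F` from the bookkeeping; exponent `0 < 10/3` (`M^0 = 1`). -/
theorem HighSpeedPressureWork_of :
    Summit.NavierStokesRegularity.NavierStokesRegularity.Theses.LevelSetModeration.HighSpeedPressureWork := by
  intro ν T hν hT
  obtain ⟨m, hm, Λ, hΛ⟩ := stub_linearLevelSetLaw ν T hν hT
  -- class-uniform speed bound on every data fibre `(E₀, B₀)`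
  have hGex : ∀ E₀ B₀ : ℝ, ∃ G : ℝ,
      ∀ (u : ℝ → EuclideanSpace ℝ (Fin 3) → EuclideanSpace ℝ (Fin 3))
        (p : ℝ → EuclideanSpace ℝ (Fin 3) → ℝ),
        Literature.Analysis.FluidPDE.IsClassicalNSSolutionOn (Set.Ico 0 T) ν 0 u p →
        Literature.Analysis.FluidPDE.IsLerayHopfOn T ν 0 (u 0) u →
        Literature.Analysis.FluidPDE.HasRapidSpatialDecay (u 0) →
        (∫ x, ‖u 0 x‖ ^ 2) ≤ E₀ → (∀ x, ‖u 0 x‖ ≤ B₀) →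
        ∀ t ∈ Set.Ico 0 T, ∀ x, ‖u t x‖ ≤ G := by
    intro E₀ B₀
    have hB : B₀ ≤ max B₀ 0 := le_max_left _ _
    have hM₀ : 0 < 2 * max B₀ 0 + 2 := by positivity
    obtain ⟨G, hG⟩ :=
      stub_uniformLevelSetClosure ν T m (Λ E₀ B₀) E₀ (2 * max B₀ 0 + 2) hν hT hm hM₀
    refine ⟨G, fun u p hcl hLH hdec hE hB₀ => hG u p hcl hLH hdec hE ?_ ?_⟩
    · intro x
      have hx := hB₀ x
      linarith
    · intro M c hM hMc hcM hc
      exact hΛ u p hcl hLH hdec E₀ B₀ hE hB₀ M c (by linarith) hMc hcM hc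
  choose G hG using hGex
  obtain ⟨F, hF⟩ := stub_boundedPairingBookkeeping ν T hν hT G
    (fun u p hcl hLH hdec E₀ B₀ hE hB₀ => hG E₀ B₀ u p hcl hLH hdec hE hB₀)
  refine ⟨0, by norm_num, F, ?_⟩
  intro u p hcl hLH hdec E₀ B₀ hE hB₀ M c t hM hMc hcM hc ht
  rw [Real.rpow_zero, mul_one]
  exact hF u p hcl hLH hdec E₀ B₀ hE hB₀ M c t hM hMc hcM hc ht

end Summit.NavierStokesRegularity.NavierStokesRegularity.Cruxes.HighSpeedPressureWork.LinearClosure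

end
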